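import Summits.ValiantsHypothesis.ValiantsHypothesis.Theses.DivisionGap
import Summits.ValiantsHypothesis.ValiantsHypothesis.Theorems.DivisionGapPerCofactorDegreeReductionLogicalPosition
import Literature.Computability.AlgebraicComplexity.PermanentIrreducible

/-!
# Sketch (ideator 4, round 2) — crux `DivisionGap.PerCofactorDegreeReduction` (stmt-ValiantsHypothesis-15046)

First lemmas of the idea card `intrinsic-member-descent` (signatures only; `sorry` bodies).
Transfer: the crux is the `h' = 1` corollary of the window form of weakly-exponential hardness of
ALL monotone multiples of `per_n` (`LogicalPosition.pcdr_of_expMultiplesHard`, tree, p142049);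
the lemmas below are the first checkable statements of the line that attacks that hypothesis.
-/

noncomputable section

set_option linter.dupNamespace false

namespace Summit.ValiantsHypothesis.ValiantsHypothesis.Cruxes.PerCofactorDegreeReduction.IntrinsicMemberDescent

open MvPolynomial Literature.Computability.AlgebraicComplexity
open Summit.ValiantsHypothesis.ValiantsHypothesis.Theses.DivisionGap
open scoped NNReal BigOperators

/-- The face permanent of a bipartite graph `G ⊆ [n]²` (cells `(row, col)`; a permutation `σ` lies
in `G` iff `(σ i, i) ∈ G` for all columns `i`) — verbatim the sibling line's `facePer`. -/
def facePer {n : ℕ} (G : Finset (Fin n × Fin n)) : MvPolynomial (Fin n × Fin n) ℝ≥0 :=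
  ∑ σ ∈ (Finset.univ : Finset (Equiv.Perm (Fin n))).filter (fun σ => ∀ i, (σ i, i) ∈ G),
    monomial (permMonomial σ) (1 : ℝ≥0)

/-- `#PM(G)`. -/
def pmCount {n : ℕ} (G : Finset (Fin n × Fin n)) : ℕ :=
  ((Finset.univ : Finset (Equiv.Perm (Fin n))).filter (fun σ => ∀ i, (σ i, i) ∈ G)).card

/-- `#PM(G; T → S)`: perfect matchings of `G` RESPECTING the split `(S, T)` (columns `T` onto rows `S`). -/
def splitCount {n : ℕ} (G : Finset (Fin n × Fin n)) (S T : Finset (Fin n)) : ℕ :=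
  ((Finset.univ : Finset (Equiv.Perm (Fin n))).filter
    (fun σ : Equiv.Perm (Fin n) => (∀ i, (σ i, i) ∈ G) ∧ T.image ⇑σ = S)).card

/-- **FIRST LEMMA (K0, provable now, size M): INTRINSIC Jerrum–Snir for face permanents.**
For every host `G` with a perfect matching there is a balanced split `(S, T)` of the degree window
such that `#PM(G) ≤ L(per_G) · #PM(G; T → S)`: the monotone cost of `per_G` is at least the MATCHING
EXPANSION `#PM(G) / max_{S,T} #PM(G; T → S)` of the host, with NO `n!` normalisation — so bounded-degree
expander hosts (where `#PM(G) ≪ n!/2^{n/3}` and the n!-normalised rich-face bound is void) are usable.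
Proof route: `PerMultiplesHard.RectangleBound.stub_rectangleBound` (p114625) at `g = per_G` (margins 1):
the typed factor `a` has 0/1 row type supported on `S`, fixed column type supported on `T`, so
`supp a × supp b` injects into the matchings of `G` respecting `(S, T)`. [folklore; JerrumSnir1982 §4] -/
theorem intrinsic_js :
    ∀ (n : ℕ), 3 ≤ n → ∀ (G : Finset (Fin n × Fin n)),
      (∃ σ : Equiv.Perm (Fin n), ∀ i, (σ i, i) ∈ G) →
      ∃ S T : Finset (Fin n), n < 3 * S.card ∧ 3 * S.card ≤ 2 * n ∧ S.card = T.card ∧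
        pmCount G ≤ complexity (facePer G) * splitCount G S T := by
  sorry

/-- **K1 (provable now, size M; a corollary of the landed many-parts face move
`PerMultiplesHard.HostDescent.stub_hostDescent`, p119267, at the weight `w = 𝟙_G`): MEMBER-SUPPORT DESCENT.**
For homogeneous `h` (free: torus normal form), any monomial `u₀` of `h` and any host `G ⊇ supp u₀` containing a perfect matching, the
multiple `per_G · (h restricted to its monomials supported inside G)` is no more expensive than `per_n · h`.
The line applies it with `G = supp u₀ ∪ σ₀ ∪ σ₁ ∪ … ∪ σ_r` (`u₀` support-minimal, `σ_j` padding matchings). -/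
theorem member_descent :
    ∀ (n : ℕ) (h : MvPolynomial (Fin n × Fin n) ℝ≥0) (D : ℕ), (∀ d ∈ h.support, d.degree = D) →
      ∀ (u₀ : (Fin n × Fin n) →₀ ℕ), u₀ ∈ h.support →
      ∀ (G : Finset (Fin n × Fin n)), u₀.support ⊆ G → (∃ σ : Equiv.Perm (Fin n), ∀ i, (σ i, i) ∈ G) →
        complexity (facePer G *
            ∑ u ∈ h.support.filter (fun u => u.support ⊆ G), monomial u (coeff u h)) ≤
          complexity (perPoly (Fin n) ℝ≥0 * h) := by
  sorry

/-- **K2 (new, size M–L, probabilistic existence stated deterministically): RANDOM MATCHING PADDING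
makes every sparse host a matching expander.**  For every graph `S₀` of maximum row/column degree `≤ d`
on `n ≥ n₀(d)` vertices there are `r ≤ 400(d+1)` permutations whose graphs, added to `S₀`, give a host `G`
whose every balanced split captures at most a `2^{-n/10}` fraction of its perfect matchings (so
`intrinsic_js` yields `L(per_G) ≥ 2^{n/10}`).  Why true: a matching of `G` respecting `(S,T)` avoids every
padding edge from `T` to `Sᶜ`.  Route (d fixed, n → ∞, r = 400(d+1) i.i.d. uniform permutations): (1) for EVERY
balanced split at least `rn/12` padding edges cross it (hypergeometric concentration per permutation,
independence over the `r` permutations beats the union bound over `≤ 4ⁿ` splits once `r ≳ 300`); (2) Brégman–Minc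
on the two allowed blocks, whose padded degrees then average `≤ d + 0.875 r ≤ 0.88 r`, gives
`splitCount ≤ (0.88 r/e)ⁿ · (2πr)^{n/r}`; (3) Egorychev–Falikman on the doubly stochastic `A_pad / r` gives
`per A_pad ≥ (r/e)ⁿ`, and the multiplicity of a matching in `A_pad` is `≤ (1 + r/n + o(1))ⁿ ≤ e^{r+o(n)}`, so
`pmCount G ≥ (r/e)ⁿ e^{-r-o(n)}`; the ratio is `≥ 2^{0.16 n − o(n)}`.  (Large `d` is not needed by the line —
fat supports go to the block/pure jaws — and is true there anyway, G being nearly complete.)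
[Schrijver1998 doi:10.1006/jctb.1997.1798; Bregman1973; Egorychev1981/Falikman1981; BollobasChung1988
doi:10.1137/0401033 (cycle + random matching: the expansion model); new combination] -/
theorem matching_padding :
    ∀ (d : ℕ), ∃ n₀ : ℕ, ∀ n ≥ n₀, ∀ (S₀ : Finset (Fin n × Fin n)),
      (∀ i : Fin n, (S₀.filter fun e => e.1 = i).card ≤ d) →
      (∀ j : Fin n, (S₀.filter fun e => e.2 = j).card ≤ d) →
      ∃ M : Finset (Equiv.Perm (Fin n)), M.card ≤ 400 * (d + 1) ∧
        ∀ S T : Finset (Fin n), n < 3 * S.card → 3 * S.card ≤ 2 * n → S.card = T.card →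
          2 ^ (n / 10) * splitCount (S₀ ∪ M.biUnion fun σ => Finset.univ.image fun i => (σ i, i)) S T ≤
            pmCount (S₀ ∪ M.biUnion fun σ => Finset.univ.image fun i => (σ i, i)) := by
  sorry

/-- **TRANSFER (tree theorem, p142049): the crux is the `h' = 1` corollary of weakly-exponential
hardness of all monotone multiples of `per_n` (window form).**  Restated here to pin the target the
line attacks; the proof is the tree's. -/
theorem transfer
    (hexp : ∃ k n₀ : ℕ, ∀ n ≥ n₀, ∀ h : MvPolynomial (Fin n × Fin n) ℝ≥0, h ≠ 0 →
      n ≤ (Nat.log 2 n + Nat.log 2 (complexity (perPoly (Fin n) ℝ≥0 * h)) + k) ^ k) :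
    PerCofactorDegreeReduction :=
  Summit.ValiantsHypothesis.ValiantsHypothesis.Theorems.DivisionGap.PerCofactorDegreeReduction.LogicalPosition.pcdr_of_expMultiplesHard
    hexp

end Summit.ValiantsHypothesis.ValiantsHypothesis.Cruxes.PerCofactorDegreeReduction.IntrinsicMemberDescent
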